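import Summits.Schanuel.Schanuel.Theorems.DiophantineDichotomyApproximationPropertyOrbitFloorLogLemmas
import Summits.Schanuel.Schanuel.Theorems.DiophantineDichotomyApproximationPropertyOrbitClusterBound
import Summits.Schanuel.Schanuel.Theorems.DiophantineDichotomyApproximationPropertyZeroDimDictionary
import Summits.Schanuel.Schanuel.Theorems.DiophantineDichotomyApproximationPropertySharpClosestPointLemmas
import Summits.Schanuel.Schanuel.Theorems.DiophantineDichotomyApproximationPropertyCycleAPIAt3GlueLemmas
import Literature.NumberTheory.EllipticCurves.HeightsBaseChangeProofs
import Literature.NumberTheory.Transcendental.PhilipponCriterionProjDist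
import HarnessLib

/-!
# Stub `orbitFloorLog_of_ratioDegree` of line `orbit-interpolation-determinant` (crux `ApproximationProperty`, stmt-Schanuel-6117)

Crux `stmt-Schanuel-6117` (`Summit.Schanuel.Schanuel.Theses.DiophantineDichotomy.ApproximationProperty`),
route `DiophantineDichotomy`, line `orbit-interpolation-determinant`, stub
`orbitFloorLog_of_ratioDegree` (lead c4 wave-2 part B′; composed with the ratio-degree lemma
`orbit_ratio_degree` — its hypothesis, verbatim — it is the skeleton stub `orbitFloorLog`, the
ORBIT FLOOR in log form = stub plan P2 of `Cruxes/ApproximationProperty/STUB-PLAN-CycleAPIAt3.md`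
plus one term `D log(L+2)`): a prime orbit `𝔭` (rank `1`, `D = deg 𝔭`, `h = h(𝔭)`) on a
`ℚ`-curve `V(𝔮)` (`𝔮 ≤ 𝔭` prime of rank `2`, `δₛ = deg 𝔮`) ALL of whose zeros stay at projective
distance `≥ e^{−L}` (`L ≥ 1`) from `ω̄ = (1 : ω)` satisfies
`log (1/|𝔭(ω̄)|) ≤ C(ω) · (δₛ L + h + D log(D+2) + D log(L+2) + √(D (h + D + δₛ log(D+2)) L))`.

Proof. (0) Dictionary (`stub_zeroDimDictionary`): number field `K`, point `b ∈ K⁴`, zeros of `𝔭`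
= multiples of the conjugates `σb`, `[K:ℚ] = D`, `h_K(b) ≤ h + cD`, and the PRODUCT FORMULA
`log (1/|𝔭(ω̄)|) ≤ cD + Σ_σ log(1/ρ_σ)`, `ρ_σ = projDist(ω̄, σb) ≥ e^{−L}` (`iabs_pos_of_far`).
(1) `b₀ = 0`: every conjugate has `ρ_σ > 1/(2|ω̄|)` (`PhilipponMain.affine_near_of_projDist_le`).
(2) `b₀ ≠ 0`: the hypothesis gives `y = b_{j+1}/b₀` of degree `n ≥ D/δₛ`; LAYER CAKE
(`OrbitFloorLogLemmas.sum_log_inv_le_sum_card`): `Σ_σ log(1/ρ_σ) ≤ Σ_{ℓ=0}^{⌊L⌋} N(ℓ)`,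
`N(ℓ) = #{σ : ρ_σ ≤ e^{−ℓ}}`; PER SHELL (`OrbitFloorLogOfRatioDegree.shell_lever`): the conjugates
of the shell `ℓ ≥ ℓ₀(ω)` are affinely near `ω` (`|σ(y) − ω_j| ≤ r = 2|ω̄|² e^{−ℓ} ≤ 1`), their
restrictions to `K' = ℚ(y)` (fibres of size `[K:K'] = D/n ≤ δₛ`,
`NumberField.card_filter_comp_algebraMap_eq`) are `k` distinct embeddings of `K'` to which the
lever `stub_orbitClusterBound` at `t = 1` applies (power basis, `h_{K'}(1:y)·[K:K'] ≤ h_K(b)` by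
`NumberField.logHeight_comp_algebraMap`, `Height.logHeight_comp_le`), whence
`N(ℓ) ≤ δₛ/c₀ + 2C₀D(log(2+‖ω‖)+1)/(c₀ℓ) + √(2C₀D(h+(c+1)D)/(c₀ℓ))`
(`OrbitFloorLogLemmas.shell_count_real`); SUM over shells (`Σ 1/ℓ ≤ 1 + log L` gives the
`D log(L+2)` term, `Σ 1/√ℓ ≤ 2√L`) and absorb (`OrbitFloorLogLemmas.absorb`). Proofs only.

Sources: NesterenkoPhilippon2001 (LNM 1752) Ch. 3 §4 (Prop. 4.13, the average form; property 3 of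
`|I(ω̄)|`); Philippon2000 (doi:10.1006/jnth.1999.2461); folklore.
-/

noncomputable section

-- `Summit.Schanuel.Schanuel.…` is the mandated summit/sub-problem namespace (single-conjunct summit), hence:
set_option linter.dupNamespace false

attribute [local instance] MvPolynomial.gradedAlgebra

namespace Summit.Schanuel.Schanuel.Cruxes.ApproximationProperty.OrbitInterpolationDeterminant

open Literature.NumberTheory.Transcendental.Nesterenko MvPolynomial
open Literature.NumberTheory.Transcendental.PhilipponMain
open scoped BigOperators IntermediateField

namespace OrbitFloorLogOfRatioDegree

/-! ## The lever on one shell: restriction to `ℚ(y)` and the orbit-cluster bound at `t = 1` -/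

/-- Fibre count of the restriction of complex embeddings to a subfield: a finite set `s` of
embeddings of `K` has at most `[K:K'] · #(restrictions)` elements
(`NumberField.card_filter_comp_algebraMap_eq`: every embedding of `K'` has exactly `[K:K']`
extensions). [folklore] -/
theorem card_le_finrank_mul_card_image {K' K : Type*} [Field K'] [NumberField K'] [Field K]
    [NumberField K] [Algebra K' K] [DecidableEq (K' →+* ℂ)] (s : Finset (K →+* ℂ)) :
    s.card ≤ Module.finrank K' K * (s.image fun σ => σ.comp (algebraMap K' K)).card := by
  classical
  refine Finset.card_le_mul_card_image s _ fun ψ _ => ?_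
  calc (s.filter fun σ => σ.comp (algebraMap K' K) = ψ).card
      ≤ (Finset.univ.filter fun σ : K →+* ℂ => σ.comp (algebraMap K' K) = ψ).card :=
        Finset.card_le_card (Finset.filter_subset_filter _ (Finset.subset_univ s))
    _ = Module.finrank K' K := by convert NumberField.card_filter_comp_algebraMap_eq ψ

/-- The power basis `1, y, …, y^{n−1}` of `ℚ(y)` (`n = deg_ℚ y`) in the lever's format: every
element of `ℚ(y)` is a polynomial of degree `≤ n − 1` in `y`. [folklore] -/
theorem adjoin_simple_span {K : Type*} [Field K] [NumberField K] (y : K) (z : ℚ⟮y⟯) :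
    ∃ Q : MvPolynomial (Fin 1) ℚ, Q.totalDegree ≤ (minpoly ℚ y).natDegree - 1 ∧
      MvPolynomial.aeval (fun _ : Fin 1 => IntermediateField.AdjoinSimple.gen ℚ y) Q = z := by
  have hy : IsIntegral ℚ y := Algebra.IsIntegral.isIntegral y
  obtain ⟨f, hf, hz⟩ := (IntermediateField.adjoin.powerBasis hy).exists_eq_aeval z
  have hdim : (IntermediateField.adjoin.powerBasis hy).dim = (minpoly ℚ y).natDegree := rfl
  have hgen : (IntermediateField.adjoin.powerBasis hy).gen = IntermediateField.AdjoinSimple.gen ℚ y :=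
    rfl
  refine ⟨Polynomial.aeval (MvPolynomial.X 0 : MvPolynomial (Fin 1) ℚ) f, ?_, ?_⟩
  · rw [Polynomial.aeval_eq_sum_range]
    refine MvPolynomial.totalDegree_finsetSum_le fun i hi => ?_
    have hi' : i ≤ f.natDegree := Nat.lt_succ_iff.mp (Finset.mem_range.mp hi)
    calc (f.coeff i • (X 0 : MvPolynomial (Fin 1) ℚ) ^ i).totalDegree
        ≤ ((X 0 : MvPolynomial (Fin 1) ℚ) ^ i).totalDegree := MvPolynomial.totalDegree_smul_le _ _
      _ ≤ i * (X 0 : MvPolynomial (Fin 1) ℚ).totalDegree := MvPolynomial.totalDegree_pow _ _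
      _ = i := by rw [MvPolynomial.totalDegree_X, mul_one]
      _ ≤ (minpoly ℚ y).natDegree - 1 := by omega
  · rw [← Polynomial.aeval_algHom_apply, MvPolynomial.aeval_X, ← hgen]
    exact hz.symm

/-- Heights: `[K:ℚ(y)] · h_{ℚ(y)}(1 : y) ≤ h_K(b)` for `y = b_{j+1}/b₀`
(`h_K = [K:K'] h_{K'}` on `K'`-rational points, projective invariance, and the height of a
coordinate projection). [folklore] -/
theorem finrank_mul_logHeight_gen_le {K : Type*} [Field K] [NumberField K] {m : ℕ}
    {b : Fin (m + 1) → K} (hb0 : b 0 ≠ 0) (j : Fin m) :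
    (Module.finrank ℚ⟮b j.succ / b 0⟯ K : ℝ) *
        Height.logHeight (Fin.cons (1 : ℚ⟮b j.succ / b 0⟯)
          (fun _ : Fin 1 => IntermediateField.AdjoinSimple.gen ℚ (b j.succ / b 0)) :
            Fin (1 + 1) → ℚ⟮b j.succ / b 0⟯) ≤
      Height.logHeight b := by
  set y := b j.succ / b 0 with hy
  rw [← NumberField.logHeight_comp_algebraMap]
  have e : (⇑(algebraMap (↥ℚ⟮y⟯) K) ∘ (Fin.cons (1 : ℚ⟮y⟯)
      (fun _ : Fin 1 => IntermediateField.AdjoinSimple.gen ℚ y) : Fin (1 + 1) → ℚ⟮y⟯)) =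
      (b 0)⁻¹ • (b ∘ (Fin.cons 0 (fun _ : Fin 1 => j.succ) : Fin (1 + 1) → Fin (m + 1))) := by
    funext i
    refine Fin.cases ?_ (fun i' => ?_) i
    · simp [hb0]
    · simp [hy, div_eq_inv_mul]
  rw [e, Height.logHeight_smul_eq_logHeight _ (inv_ne_zero hb0)]
  exact Height.logHeight_comp_le _ _

/-- `log (n + 1) ≤ n`. [folklore] -/
theorem log_nat_succ_le (n : ℕ) : Real.log ((n : ℝ) + 1) ≤ n := by
  calc Real.log ((n : ℝ) + 1) ≤ Real.log (Real.exp n) :=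
        Real.log_le_log (by positivity) (Real.add_one_le_exp (n : ℝ))
    _ = n := Real.log_exp _

/-- **The lever on one shell.** Let `T` be a set of complex embeddings `σ` of the number field `K`
with `|σ(y) − x₀| ≤ r ≤ 1`, `y = b_{j+1}/b₀`, `n = deg_ℚ y`, `f = [K:ℚ(y)]` (`f n = [K:ℚ]`). The
restrictions `σ|_{ℚ(y)}` form `k ≥ #T/f` DISTINCT embeddings of `ℚ(y)` putting `y` in the disc
`|z − x₀| ≤ r`, and the orbit-cluster bound at `t = 1` for `ℚ(y)` (power basis, `δ = n − 1`) reads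
`(c₀k² − k) log(1/r) ≤ C₀ (W + kV)` with `f² W ≤ [K:ℚ](h_K(b) + [K:ℚ])`,
`f V ≤ [K:ℚ](log(2+|x₀|) + 1)` (using `log(n+1) ≤ n`). [folklore] -/
theorem shell_lever {c₀ C₀ : ℝ}
    (hocb1 : ∀ (K : Type) [Field K] [NumberField K] (β : Fin 1 → K) (δ k : ℕ)
      (σ : Fin k → (K →+* ℂ)) (x : Fin 1 → ℂ) (r : ℝ),
      (∀ z : K, ∃ Q : MvPolynomial (Fin 1) ℚ, Q.totalDegree ≤ δ ∧ MvPolynomial.aeval β Q = z) →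
      Function.Injective σ → 0 < r → r ≤ 1 →
      (∀ i, ‖(fun j => σ i (β j)) - x‖ ≤ r) →
      (c₀ * (k : ℝ) ^ (1 + 1 / ((1 : ℕ) : ℝ)) - k) * Real.log (1 / r) ≤
        C₀ * (δ * Height.logHeight (Fin.cons (1 : K) β : Fin (1 + 1) → K) +
          Module.finrank ℚ K * Real.log (Module.finrank ℚ K + 1) +
          k * δ * Real.log (2 + ‖x‖) + k * Real.log ((δ : ℝ) + 2)))
    {K : Type} [Field K] [NumberField K] {m : ℕ} {b : Fin (m + 1) → K} (hb0 : b 0 ≠ 0) (j : Fin m)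
    (x0 : ℂ) {r : ℝ} (hr0 : 0 < r) (hr1 : r ≤ 1) (T : Finset (K →+* ℂ))
    (hT : ∀ σ ∈ T, ‖σ (b j.succ / b 0) - x0‖ ≤ r) :
    ∃ (k f : ℕ) (W V : ℝ), T.card ≤ f * k ∧
      f * (minpoly ℚ (b j.succ / b 0)).natDegree = Module.finrank ℚ K ∧
      0 ≤ W ∧ 0 ≤ V ∧
      (f : ℝ) ^ 2 * W ≤ Module.finrank ℚ K * (Height.logHeight b + Module.finrank ℚ K) ∧
      (f : ℝ) * V ≤ Module.finrank ℚ K * (Real.log (2 + ‖x0‖) + 1) ∧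
      (c₀ * (k : ℝ) ^ 2 - k) * Real.log (1 / r) ≤ C₀ * (W + k * V) := by
  classical
  set y := b j.succ / b 0 with hy
  set K' : IntermediateField ℚ K := ℚ⟮y⟯ with hK'
  set n := (minpoly ℚ y).natDegree with hn
  set f := Module.finrank K' K with hf
  have hyint : IsIntegral ℚ y := Algebra.IsIntegral.isIntegral y
  have hK'n : Module.finrank ℚ K' = n := IntermediateField.adjoin.finrank hyint
  have hfn : f * n = Module.finrank ℚ K := by
    rw [mul_comm, ← hK'n]; exact Module.finrank_mul_finrank ℚ K' K
  have hn1 : 1 ≤ n := minpoly.natDegree_pos hyint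
  -- the distinct restrictions to `K'`
  set res : (K →+* ℂ) → (K' →+* ℂ) := fun σ => σ.comp (algebraMap K' K) with hres
  set T' := T.image res with hT'
  set k := T'.card with hk
  set σ' : Fin k → (K' →+* ℂ) := fun i => (T'.equivFin.symm i : K' →+* ℂ) with hσ'
  have hσ'inj : Function.Injective σ' :=
    Subtype.val_injective.comp T'.equivFin.symm.injective
  have hσ'mem : ∀ i, σ' i ∈ T' := fun i => (T'.equivFin.symm i).2
  set g := IntermediateField.AdjoinSimple.gen ℚ y with hg
  set β' : Fin 1 → K' := fun _ => g with hβ'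
  set x : Fin 1 → ℂ := fun _ => x0 with hx
  have hxn : ‖x‖ = ‖x0‖ := pi_norm_const x0
  have hnear : ∀ i, ‖(fun j => σ' i (β' j)) - x‖ ≤ r := by
    intro i
    obtain ⟨σ, hσT, hσ⟩ := Finset.mem_image.mp (hσ'mem i)
    have hval : σ' i g = σ y := by
      rw [← hσ, hres]
      show σ (algebraMap K' K g) = σ y
      rw [hg, IntermediateField.AdjoinSimple.algebraMap_gen]
    have e : (fun j => σ' i (β' j)) - x = fun _ => σ y - x0 := by
      funext j'; simp [hβ', hx, hval]
    rw [e, pi_norm_const]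
    exact hT σ hσT
  -- the lever
  have hlev := hocb1 K' β' (n - 1) k σ' x r (fun z => adjoin_simple_span y z) hσ'inj hr0 hr1 hnear
  have hexp : (k : ℝ) ^ (1 + 1 / ((1 : ℕ) : ℝ)) = (k : ℝ) ^ 2 := by norm_num
  rw [hexp, hK'n, hxn] at hlev
  set H' := Height.logHeight (Fin.cons (1 : K') β' : Fin (1 + 1) → K') with hH'
  have hH'0 : 0 ≤ H' := Height.logHeight_nonneg _
  have hfH : (f : ℝ) * H' ≤ Height.logHeight b := finrank_mul_logHeight_gen_le hb0 j
  have hn1r : ((n - 1 : ℕ) : ℝ) = n - 1 := by rw [Nat.cast_sub hn1, Nat.cast_one]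
  have hlogn : Real.log ((n : ℝ) + 1) ≤ n := log_nat_succ_le n
  have hlogn0 : 0 ≤ Real.log ((n : ℝ) + 1) :=
    Real.log_nonneg (by linarith [(Nat.cast_nonneg n : (0 : ℝ) ≤ n)])
  have hlogx0 : 0 ≤ Real.log (2 + ‖x0‖) := Real.log_nonneg (by linarith [norm_nonneg x0])
  have hDr : (Module.finrank ℚ K : ℝ) = f * n := by rw [← hfn]; push_cast; ring
  have hf0 : (0 : ℝ) ≤ f := Nat.cast_nonneg f
  have hn1' : (1 : ℝ) ≤ n := by exact_mod_cast hn1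
  refine ⟨k, f, (n - 1 : ℕ) * H' + n * Real.log (n + 1),
    (n - 1 : ℕ) * Real.log (2 + ‖x0‖) + Real.log ((n - 1 : ℕ) + 2), ?_, hfn, ?_, ?_, ?_, ?_, ?_⟩
  · exact card_le_finrank_mul_card_image T
  · rw [hn1r]; positivity
  · rw [hn1r]
    have : Real.log ((n : ℝ) - 1 + 2) = Real.log (n + 1) := by ring_nf
    rw [this]; positivity
  · rw [hn1r, hDr]
    have h1 : (f : ℝ) ^ 2 * ((n - 1) * H') ≤ f * n * (f * H') := by nlinarith
    have h2 : (f : ℝ) ^ 2 * (n * Real.log (n + 1)) ≤ f * n * (f * n) := by nlinarith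
    nlinarith [Height.logHeight_nonneg b]
  · rw [hn1r, hDr]
    have e2 : Real.log ((n : ℝ) - 1 + 2) = Real.log (n + 1) := by ring_nf
    rw [e2]
    nlinarith
  · have e2 : ((n - 1 : ℕ) : ℝ) + 2 = (n : ℝ) + 1 := by rw [hn1r]; ring
    have e3 : Real.log (((n - 1 : ℕ) : ℝ) + 2) = Real.log ((n : ℝ) + 1) := by rw [e2]
    rw [e3]
    convert hlev using 1
    rw [e3]; ring

end OrbitFloorLogOfRatioDegree

/-! ## The stub -/

open OrbitFloorLogLemmas OrbitFloorLogOfRatioDegree in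
/-- **Stub `orbitFloorLog_of_ratioDegree`** (lead c4 wave-2 part B′ of line
`orbit-interpolation-determinant`): the ratio-degree lemma (= neighbour stub `orbit_ratio_degree`,
taken as the hypothesis) implies the ORBIT FLOOR in log form — a prime orbit `𝔭` (`D = deg 𝔭`,
`h = h(𝔭)`) on a `ℚ`-curve `V(𝔮)` (`δₛ = deg 𝔮`, `𝔮 ≤ 𝔭`) all of whose zeros stay at projective
distance `≥ e^{−L}` from `ω̄ = (1 : ω)` has
`log (1/|𝔭(ω̄)|) ≤ C(ω) · (δₛ L + h + D log(D+2) + D log(L+2) + √(D (h + D + δₛ log(D+2)) L))`.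
Product formula (dictionary (D)) + layer cake over the shells `projDist ≤ e^{−ℓ}` + the lever
`OrbitClusterBound` at `t = 1` on `ℚ(b_{j+1}/b₀)` (fibres of the restriction `≤ δₛ`).
[cite: NesterenkoPhilippon2001, Ch. 3 §4 (Prop. 4.13, average form)] -/
theorem orbitFloorLog_of_ratioDegree : (∀ (𝔭 𝔮 : Ideal (Rx 3)), 𝔭.IsPrime → 𝔭.IsHomogeneous (homogeneousSubmodule (Fin (3 + 1)) ℚ) → IsUnmixedOfRank 𝔭 1 → 𝔮.IsPrime → 𝔮.IsHomogeneous (homogeneousSubmodule (Fin (3 + 1)) ℚ) → IsUnmixedOfRank 𝔮 2 → 𝔮 ≤ 𝔭 → ∀ (K : Type) [Field K] [NumberField K] (b : Fin (3 + 1) → K), b 0 ≠ 0 → (∀ β : Fin (3 + 1) → ℂ, β ∈ projZeros 𝔭 ↔ β ≠ 0 ∧ ∃ (σ : K →+* ℂ) (l : ℂ), β = fun j => l * σ (b j)) → Module.finrank ℚ K = ideg 𝔭 1 → ∃ j : Fin 3, ideg 𝔭 1 ≤ ideg 𝔮 2 * (minpoly ℚ (b j.succ / b 0)).natDegree) → ∀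 ω : Fin 3 → ℂ, ∃ C : ℝ, 0 < C ∧ ∀ (𝔭 𝔮 : Ideal (Rx 3)) (L : ℝ), 𝔭.IsPrime → 𝔭.IsHomogeneous (homogeneousSubmodule (Fin (3 + 1)) ℚ) → IsUnmixedOfRank 𝔭 1 → 𝔮.IsPrime → 𝔮.IsHomogeneous (homogeneousSubmodule (Fin (3 + 1)) ℚ) → IsUnmixedOfRank 𝔮 2 → 𝔮 ≤ 𝔭 → 1 ≤ L → (∀ β ∈ projZeros 𝔭, Real.exp (-L) ≤ projDist (Fin.cons 1 ω) β) → Real.log (1 / iabs 𝔭 1 (Fin.cons 1 ω)) ≤ C * ((ideg 𝔮 2 : ℝ) * L + iheight 𝔭 1 + (ideg 𝔭 1 : ℝ) * Real.log ((ideg 𝔭 1 : ℝ) + 2) + (ideg 𝔭 1 : ℝ) * Real.log (L + 2) + Real.sqrt ((ideg 𝔭 1 : ℝ) * (iheight 𝔭 1 + ideg 𝔭 1 + (ideg 𝔮 2 : ℝ) * Real.log ((ideg 𝔭 1 : ℝ) + 2)) * L)) := by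
  classical
  intro hRD ω
  obtain ⟨c, hc, hdict⟩ := stub_zeroDimDictionary 3 (by norm_num)
  obtain ⟨c₀, hc₀, C₀, hC₀, hocb⟩ := stub_orbitClusterBound 1 le_rfl
  set ωb : Fin (3 + 1) → ℂ := Fin.cons 1 ω with hωb
  set Θ : ℝ := ‖ωb‖ with hΘ
  have hΘ1 : 1 ≤ Θ := one_le_norm_cons_one ω
  set Lω : ℝ := Real.log (2 + ‖ω‖) with hLω
  have hLω0 : 0 ≤ Lω := Real.log_nonneg (by linarith [norm_nonneg ω])
  set Θl : ℝ := Real.log (2 * Θ) with hΘl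
  have hΘl0 : 0 ≤ Θl := Real.log_nonneg (by linarith)
  set ℓ₀ : ℕ := ⌈2 * Real.log (2 * Θ ^ 2)⌉₊ + 1 with hℓ₀
  have hℓ₀r : 0 ≤ (ℓ₀ : ℝ) := Nat.cast_nonneg _
  set Cb : ℝ := c + 1 + Θl + 1 / c₀ + 2 * (2 * C₀ * (Lω + 1) / c₀ + (ℓ₀ : ℝ)) +
    2 * Real.sqrt (2 * C₀ * (c + 1) / c₀) with hCb
  have hCb0 : 0 < Cb := by
    have : 0 ≤ 1 / c₀ + 2 * (2 * C₀ * (Lω + 1) / c₀ + (ℓ₀ : ℝ)) +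
        2 * Real.sqrt (2 * C₀ * (c + 1) / c₀) := by positivity
    rw [hCb]; linarith
  refine ⟨Cb, hCb0, ?_⟩
  intro 𝔭 𝔮 L h𝔭 hhom hunm h𝔮 hhom𝔮 hunm𝔮 hle hL hfar
  obtain ⟨K, _i1, _i2, b, hb0, hA, -, hB, hCht, hDval, -⟩ := hdict 𝔭 h𝔭 hhom hunm
  have hRD' : b 0 ≠ 0 → ∃ j : Fin 3, ideg 𝔭 1 ≤ ideg 𝔮 2 * (minpoly ℚ (b j.succ / b 0)).natDegree :=
    fun hb00 => hRD 𝔭 𝔮 h𝔭 hhom hunm h𝔮 hhom𝔮 hunm𝔮 hle K b hb00 hA hB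
  have hiabs : 0 < iabs 𝔭 1 ωb :=
    iabs_pos_of_far 𝔭 ω h𝔭 hhom hunm fun β hβ => (Real.exp_pos _).trans_le (hfar β hβ)
  have hh0 : 0 ≤ iheight 𝔭 1 := height_nonneg _
  generalize hDdef : ideg 𝔭 1 = D at hB hCht hDval hRD' ⊢
  generalize hhdef : iheight 𝔭 1 = hgt at hCht hh0 ⊢
  generalize hδdef : ideg 𝔮 2 = δs at hRD' ⊢
  have hD0 : 0 < D := by rw [← hB]; exact Module.finrank_pos
  have hD1 : (1 : ℝ) ≤ D := by exact_mod_cast hD0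
  have hDr0 : (0 : ℝ) ≤ D := Nat.cast_nonneg D
  have hδs0 : (0 : ℝ) ≤ δs := Nat.cast_nonneg δs
  have hcard : Fintype.card (K →+* ℂ) = D := by rw [NumberField.Embeddings.card, hB]
  -- the conjugates and the product formula (dictionary (D))
  set ρ : (K →+* ℂ) → ℝ := fun σ => projDist ωb fun j => σ (b j) with hρ
  have hρL : ∀ σ, Real.exp (-L) ≤ ρ σ := fun σ =>
    hfar _ ((hA _).mpr ⟨sharp_conj_ne_zero σ hb0, σ, 1, by simp⟩)
  have hρ0 : ∀ σ, 0 < ρ σ := fun σ => (Real.exp_pos _).trans_le (hρL σ)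
  have hS0 : Real.log (1 / iabs 𝔭 1 ωb) ≤ c * D + ∑ σ, Real.log (1 / ρ σ) := by
    have hval := hDval ωb (cons_one_ne_zero ω)
    have hprod : 0 < ∏ σ : K →+* ℂ, ρ σ := Finset.prod_pos fun σ _ => hρ0 σ
    have h1 := Real.log_le_log (by positivity) hval
    rw [Real.log_mul (Real.exp_pos _).ne' hprod.ne', Real.log_exp,
      Real.log_prod (s := Finset.univ) (fun σ _ => (hρ0 σ).ne')] at h1
    have e : ∑ σ, Real.log (1 / ρ σ) = -∑ σ, Real.log (ρ σ) := by
      rw [← Finset.sum_neg_distrib]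
      exact Finset.sum_congr rfl fun σ _ => by rw [one_div, Real.log_inv]
    rw [e, one_div, Real.log_inv]
    linarith
  by_cases hb00 : b 0 = 0
  · -- degenerate chart: every conjugate is far from the affine point `ω̄`
    have hfarσ : ∀ σ, Real.log (1 / ρ σ) ≤ Θl := by
      intro σ
      have hne : ¬ (ρ σ * Θ ≤ 1 / 2) := fun hd =>
        (affine_near_of_projDist_le ω (sharp_conj_ne_zero σ hb0) hd).1 (by simp [hb00])
      push Not at hne
      refine Real.log_le_log (by have := hρ0 σ; positivity) ?_
      rw [div_le_iff₀ (hρ0 σ)]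
      nlinarith [hρ0 σ]
    have hS : ∑ σ, Real.log (1 / ρ σ) ≤ D * Θl := by
      calc ∑ σ, Real.log (1 / ρ σ) ≤ ∑ _σ : K →+* ℂ, Θl :=
            Finset.sum_le_sum fun σ _ => hfarσ σ
        _ = D * Θl := by rw [Finset.sum_const, Finset.card_univ, hcard, nsmul_eq_mul]
    exact absorb_far hc hc₀ hC₀ hLω0 hΘl0 hℓ₀r hD1 hh0 hδs0 hL (hS0.trans (by linarith))
  · -- the chart `b₀ ≠ 0`: the ratio `y = b_{j+1}/b₀` of degree `n ≥ D/δₛ`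
    obtain ⟨j, hj⟩ := hRD' hb00
    set y : K := b j.succ / b 0 with hy
    have hn1 : 1 ≤ (minpoly ℚ y).natDegree :=
      minpoly.natDegree_pos (Algebra.IsIntegral.isIntegral y)
    -- layer cake
    have hS1 := sum_log_inv_le_sum_card ρ hρL
    set Nf : ℕ := ⌊L⌋₊ with hNf
    have hTD : ∀ ℓ : ℕ,
        ((Finset.univ.filter fun σ => ρ σ ≤ Real.exp (-(ℓ : ℝ))).card : ℝ) ≤ D := fun ℓ => by
      have : (Finset.univ.filter fun σ => ρ σ ≤ Real.exp (-(ℓ : ℝ))).card ≤ D :=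
        (Finset.card_filter_le _ _).trans (by rw [Finset.card_univ, hcard])
      exact_mod_cast this
    -- per-shell bound from the lever, for `ℓ ≥ ℓ₀`
    have hshell : ∀ ℓ : ℕ, ℓ₀ ≤ ℓ →
        ((Finset.univ.filter fun σ => ρ σ ≤ Real.exp (-(ℓ : ℝ))).card : ℝ) ≤
          δs / c₀ + 2 * C₀ * D * (Lω + 1) / c₀ / ℓ +
            Real.sqrt (2 * C₀ * D * (hgt + c * D + D) / c₀ / ℓ) := by
      intro ℓ hℓ
      have hℓr : (ℓ₀ : ℝ) ≤ ℓ := by exact_mod_cast hℓ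
      have hℓ₀1 : 2 * Real.log (2 * Θ ^ 2) + 1 ≤ (ℓ₀ : ℝ) := by
        rw [hℓ₀]; push_cast
        linarith [Nat.le_ceil (2 * Real.log (2 * Θ ^ 2))]
      have hlogΘ2 : 0 ≤ Real.log (2 * Θ ^ 2) := Real.log_nonneg (by nlinarith)
      have hℓpos : (0 : ℝ) < ℓ := by linarith
      set r : ℝ := 2 * Θ ^ 2 * Real.exp (-(ℓ : ℝ)) with hr
      have hr0 : 0 < r := by positivity
      have hlr_eq : Real.log (1 / r) = ℓ - Real.log (2 * Θ ^ 2) := by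
        rw [hr, one_div, Real.log_inv, Real.log_mul (by positivity) (Real.exp_pos _).ne',
          Real.log_exp]
        ring
      have hlr : (ℓ : ℝ) / 2 ≤ Real.log (1 / r) := by rw [hlr_eq]; linarith
      have hr1 : r ≤ 1 := by
        have h1 : 0 ≤ Real.log (1 / r) := by linarith
        have h2 : 1 ≤ 1 / r := by
          by_contra hlt
          push Not at hlt
          exact absurd (Real.log_neg (by positivity) hlt) (not_lt.mpr h1)
        rwa [le_div_iff₀ hr0, one_mul] at h2
      have hTr : ∀ σ ∈ (Finset.univ.filter fun σ => ρ σ ≤ Real.exp (-(ℓ : ℝ))),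
          ‖σ (b j.succ / b 0) - ω j‖ ≤ r := by
        intro σ hσ
        have hσ' : ρ σ ≤ Real.exp (-(ℓ : ℝ)) := (Finset.mem_filter.mp hσ).2
        have hd : ρ σ * Θ ≤ 1 / 2 := by
          have a1 : ρ σ * Θ ≤ Real.exp (-(ℓ : ℝ)) * Θ :=
            mul_le_mul_of_nonneg_right hσ' (by linarith)
          have a2 : Real.exp (-(ℓ : ℝ)) * Θ ≤ Real.exp (-(ℓ : ℝ)) * Θ ^ 2 := by
            refine mul_le_mul_of_nonneg_left ?_ (Real.exp_pos _).le
            nlinarith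
          have a3 : Real.exp (-(ℓ : ℝ)) * Θ ^ 2 = r / 2 := by rw [hr]; ring
          linarith
        obtain ⟨-, -, hz⟩ := affine_near_of_projDist_le ω (sharp_conj_ne_zero σ hb0) hd
        have h1 := hz j
        rw [← map_div₀] at h1
        refine h1.trans ?_
        rw [hr]
        exact mul_le_mul_of_nonneg_left hσ' (by positivity)
      obtain ⟨k, f, W, V, hNk, hfn, hW, hV, hfW, hfV, hlev⟩ :=
        shell_lever hocb hb00 j (ω j) hr0 hr1 _ hTr
      rw [hB] at hfn hfW hfV
      have hfδ : (f : ℝ) ≤ δs := by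
        have : f * (minpoly ℚ y).natDegree ≤ δs * (minpoly ℚ y).natDegree := by rw [hfn]; exact hj
        exact_mod_cast Nat.le_of_mul_le_mul_right this hn1
      have hωj : Real.log (2 + ‖ω j‖) ≤ Lω :=
        Real.log_le_log (by positivity) (by linarith [norm_le_pi_norm ω j])
      exact shell_count_real hc₀ hC₀ hℓpos hlr hNk hfδ hW hV hfW hfV hDr0 hCht hωj hlev
    -- uniform per-shell bound at `ℓ = i + 1`
    have hshell' : ∀ i : ℕ, i < Nf →
        ((Finset.univ.filter fun σ => ρ σ ≤ Real.exp (-((i + 1 : ℕ) : ℝ))).card : ℝ) ≤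
          δs / c₀ + (2 * C₀ * D * (Lω + 1) / c₀ + ℓ₀ * D) / ((i : ℝ) + 1) +
            Real.sqrt (2 * C₀ * D * (hgt + c * D + D) / c₀) * (1 / Real.sqrt ((i : ℝ) + 1)) := by
      intro i _
      have e : ((i + 1 : ℕ) : ℝ) = (i : ℝ) + 1 := by push_cast; ring
      refine shell_uniform (ℓ := (i : ℝ) + 1) (ℓ₀ := (ℓ₀ : ℝ)) (by positivity) hDr0
        (by positivity) (by positivity) (by positivity) hℓ₀r (hTD (i + 1)) fun hle => ?_
      have := hshell (i + 1) (by exact_mod_cast hle)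
      rw [e] at this ⊢
      exact this
    have hsum := sum_shell_le (N := Nf) (by positivity) (Real.sqrt_nonneg _)
      (fun ℓ => ((Finset.univ.filter fun σ => ρ σ ≤ Real.exp (-(ℓ : ℝ))).card : ℝ)) hshell'
    have htot : ∑ ℓ ∈ Finset.range (Nf + 1),
        ((Finset.univ.filter fun σ => ρ σ ≤ Real.exp (-(ℓ : ℝ))).card : ℝ) ≤
        D + (Nf * (δs / c₀) + (2 * C₀ * D * (Lω + 1) / c₀ + ℓ₀ * D) * (1 + Real.log Nf) +
          Real.sqrt (2 * C₀ * D * (hgt + c * D + D) / c₀) * (2 * Real.sqrt Nf)) := by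
      rw [Finset.sum_range_succ']
      refine (add_le_add hsum (hTD 0)).trans (le_of_eq ?_)
      ring
    have hNf1 : (1 : ℝ) ≤ Nf := by exact_mod_cast Nat.floor_pos.mpr hL
    have hNfL : (Nf : ℝ) ≤ L := Nat.floor_le (by linarith)
    refine absorb hc hc₀ hC₀ hLω0 hΘl0 hℓ₀r hD1 hh0 hδs0 hL hNf1 hNfL ?_
    have hS1' : ∑ σ, Real.log (1 / ρ σ) ≤ ∑ ℓ ∈ Finset.range (Nf + 1),
        ((Finset.univ.filter fun σ => ρ σ ≤ Real.exp (-(ℓ : ℝ))).card : ℝ) := hS1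
    linarith

end Summit.Schanuel.Schanuel.Cruxes.ApproximationProperty.OrbitInterpolationDeterminant

end
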